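import Literature.IUT.HodgeTheaters.ThetaHodgeTheatersRemarksA
import Literature.IUT.HodgeTheaters.KappaCoricGalois
import HarnessLib

/-!
# [IUTchI] Rmk 3.1.7 (iv): the two typings of the `κ-sol` vocabulary agree

Remark 3.1.7 (iv) of [IUTchI] (kurims p. 68–69) [claim: Mochizuki2012, status: disputed] was typed
twice on 2026-08-25: the statement of record `KappaSolGalois.IsKappaSolOpen` / `autKappaSol` /
`CenterFree` (`KappaCoricGalois.lean`, seat abc-iut-L5-t2) and the secondary reading
`KappaSol.IsKSolOpen` / `aut` / `CenterFree` (`ThetaHodgeTheatersRemarksA.lean`, seat abc-iut-L3-t8,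
which adds `Out_{κ-sol}`, the conjugation square and the proof of "center-free ⇒ cartesian").  This
proof-only file records, kernel-checked, that the two readings COINCIDE (L5-lead ruling 19:05:51Z:
"the two typings of Rmk 3.1.7 (iv) should AGREE in content"): the `κ-sol`-open subgroups are the same
predicate, the two automorphism groups `Aut_{κ-sol}` are the same subgroup of `Aut(N)` ("preserves
`H`" as `φ x ∈ H ↔ x ∈ H` versus `H.map φ = H`), and the secondary `CenterFree` is the record one
instantiated at the absolute Galois group `Gal(L̄_C/L_C) = (Ω ≃ₐ[K] Ω)` and `N = Gal(L̄_C/M)`.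
Consequently the cartesian-square theorem `KappaSol.toPullback_aut_bijective` applies verbatim to the
objects of record.
-/

namespace Literature.IUT.HodgeTheaters

universe u

variable {Γ : Type u} [Group Γ] [TopologicalSpace Γ] (N : Subgroup Γ)

/-- The two typings of "κ-sol-open subgroup" are the same predicate (definitionally).
[claim: Mochizuki2012, status: disputed] -/
theorem KappaSol.isKSolOpen_iff_isKappaSolOpen (H : Subgroup N) :
    KappaSol.IsKSolOpen N H ↔ KappaSolGalois.IsKappaSolOpen N H :=
  Iff.rfl

omit [TopologicalSpace Γ] in
/-- "preserves `H`" pointwise (`φ x ∈ H ↔ x ∈ H`) is the same as setwise (`H.map φ = H`) for an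
automorphism `φ`. PROVED. [claim: Mochizuki2012, status: disputed] -/
theorem KappaSol.preserves_iff_map_eq (φ : MulAut N) (H : Subgroup N) :
    KappaSol.Preserves N φ H ↔ H.map φ.toMonoidHom = H := by
  constructor
  · intro h
    ext x
    simp only [Subgroup.mem_map, MulEquiv.coe_toMonoidHom]
    constructor
    · rintro ⟨y, hy, rfl⟩
      exact (h y).mpr hy
    · intro hx
      exact ⟨φ.symm x, (h (φ.symm x)).mp (by simpa using hx), by simp⟩
  · intro h x
    constructor
    · intro hx
      rw [← h] at hx
      obtain ⟨y, hy, hyx⟩ := hx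
      rw [MulEquiv.coe_toMonoidHom] at hyx
      rwa [← φ.injective hyx]
    · intro hx
      rw [← h]
      exact ⟨x, hx, rfl⟩

/-- The two typings of `Aut_{κ-sol}(N) ⊆ Aut(N)` are the same subgroup. PROVED.
[claim: Mochizuki2012, status: disputed] -/
theorem KappaSol.aut_eq_autKappaSol : KappaSol.aut N = KappaSolGalois.autKappaSol N := by
  ext φ
  rw [KappaSol.mem_aut_iff]
  change _ ↔ Continuous φ ∧ Continuous φ.symm ∧
    ∀ H : Subgroup N, KappaSolGalois.IsKappaSolOpen N H → H.map φ.toMonoidHom = H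
  simp only [KappaSol.isKSolOpen_iff_isKappaSolOpen, KappaSol.preserves_iff_map_eq]

/-- The secondary `KappaSol.CenterFree K Ω M` is the record `KappaSolGalois.CenterFree` at the
subgroup `Gal(Ω/M) ⊆ Gal(Ω/K)` (definitionally). [claim: Mochizuki2012, status: disputed] -/
theorem KappaSol.centerFree_iff (K Ω : Type*) [Field K] [Field Ω] [Algebra K Ω]
    (M : IntermediateField K Ω) :
    KappaSol.CenterFree K Ω M ↔ KappaSolGalois.CenterFree M.fixingSubgroup :=
  Iff.rfl

/-- Hence the cartesian square of Rmk 3.1.7 (iv) (secondary file) holds for the objects of record: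
for a topological group `Γ` with normal subgroup `N` that is center-free in the record sense, the
canonical map `Γ → Γ/N ×_{Out(N)} Aut_{κ-sol}(N)` is bijective. PROVED.
[claim: Mochizuki2012, status: disputed] -/
theorem KappaSolGalois.toPullback_bijective_of_centerFree [IsTopologicalGroup Γ] [N.Normal]
    (hZ : KappaSolGalois.CenterFree N) :
    Function.Bijective (KappaSol.toPullback N (KappaSol.aut N) (KappaSol.conjNormal_mem_aut N)) :=
  KappaSol.toPullback_aut_bijective N hZ

end Literature.IUT.HodgeTheaters
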